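import Mathlib.CategoryTheory.Groupoid
import Mathlib.CategoryTheory.Iso
import Literature.AnabelianGeometry.AbsoluteAnabelian.MonoAnalyticLogShells
import Literature.IUT.HodgeTheaters.PolyIsoFunctoriality
import HarnessLib

/-!
# [IUTchII] Cor 4.5 (ii) / Cor 4.6 (ii) / Cor 4.10 (v): the category of collections of data
# `(C^⊩, Prime(C^⊩) ⥲ V̲, {ρ_v}_{v ∈ V̲})` and its `ℝ_{>0}`-torsor structure

abc-iut cell (D-0067 wave 4), seat abc-iut-w4-d009 (gen 2); part 1 of the «prove in-cone at the model» disposition of GAP row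
G-w4d009-1 ([IUTchII] side; part 2 = `RealifiedDFunctor.lean`, the functor `‡D^⊢ ↦ D^⊩(‡D^⊢)`). S. Mochizuki, *Inter-universal
Teichmüller theory II*, kurims manuscript (Dec 2020) [paper:url-5036b4059555], read on the page (own render): Cor 4.5 (ii) p.132
l.4–7 «each submonoid `R_{≥0}(‡D^⊢)_v` is equipped with a distinguished element `log^{‡D^⊢}(p_v) ∈ R_{≥0}(‡D^⊢)_v`», l.19–37 (the data
`(D^⊩(‡D^⊢), Prime(D^⊩(‡D^⊢)) ⥲ V̲, {‡ρ_{D^⊩,v}}_v)`, quoted in `RealifiedDFunctor.lean`); Cor 4.6 (ii) p.138 l.2–7 «there is an isomorphism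
of Frobenioids `‡C^⊩ ⥲ D^⊩(‡D^⊢)` that is uniquely determined by the condition that it be compatible with the respective bijections
`Prime(−) ⥲ V̲` and local isomorphisms of topological monoids for each `v ∈ V̲`»; Cor 4.10 (v) p.161 l.2–3 «consisting of a Frobenioid,
a bijection, and a collection of isomorphisms of topological monoids indexed by `V̲`», l.30–33 «Here, the “`R_{>0}`-orbits” are
defined relative to the natural `R_{>0}`-actions on the Frobenioids involved obtained by multiplying the “arithmetic degrees” by a
given element `∈ R_{>0}` [cf. [FrdI], Example 6.3; [FrdI], Theorem 6.4, (ii); [IUTchI], Remark 3.1.5].» Claim key `Mochizuki2012`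
DISPUTED (D-0012).

WHAT IS TYPED (coordinates disclosed). OBJECTS `RlfData V`: for each `v` the TARGET rank-one line `R_v` with its distinguished
element — an `RLine` of abc-iut-L4-t3 (`MonoAnalyticLogShells.lean`, [AbsTopIII] Prop 5.8 (iii)/(vi): `R_{≥0}(‡D^⊢)_v ∋ log^{‡D^⊢}(p_v)`,
or `Ψ^R_{‡F^⊢_v}` with the element of Prop 4.2 (ii)/4.4 (ii)) — and the POSITIVE scalar of `ρ_v` on the element of ARITHMETIC DEGREE
`1` of the prime component `Φ_{C,v} ≅ ℝ_{≥0}` (degree coordinates: the tree's realified Frobenioid records carry `deg`/`localDeg`,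
abc-iut-L6-t2 `RealifiedGlobalFrobenioidF`); `Prime(C) ⥲ V̲` is the indexing. MORPHISMS `RlfData.Hom`: the DEGREE `deg > 0` of the
equivalence of Frobenioids ([FrdI] Thm 6.4 (ii) «`deg(Ψ^rlf) ∈ ℝ_{>0}`», tree `Literature.AlgebraicGeometry.Frobenioids.Thm64iiDeg`;
ONE scalar for all `v` — an equivalence of `C^⊩_mod` preserves the `ℝ`-span of principal divisors, the degree-zero hyperplane,
which a prime-wise scaling preserves iff all its scalars agree), a `V̲`-indexed family of linear isomorphisms `R_{X,v} ⥲ R_{Y,v}`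
(NOT required to match distinguished elements), and the compatibility square with the `ρ_v`.

PROVED. Hom-sets are `ℝ_{>0}`-TORSORS: a morphism is determined by its degree (`Hom.ext_of_deg_eq`; line isomorphisms forced,
`lineIso_frob`), every degree occurs (`degEquiv`), the `ℝ_{>0}`-action «multiplying the arithmetic degrees» is `dilate`
(`dilate_ne_id`: `Aut(X) ≅ ℝ_{>0}`, the ambient category is NOT rigid), the `ℝ_{>0}`-ORBIT of an isomorphism of data is the FULL
poly-isomorphism (`orbit_eq_full`); Cor 4.6 (ii)'s «uniquely determined» in the sharp form "ONE local isomorphism pins the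
morphism" (`hom_ext_of_lineIso_eq`); a morphism Frobenius-preserving at some `v` has degree `c_{X,v}/c_{Y,v}`, so a
Frobenius-preserving ENDOMORPHISM is the identity (`eq_id_of_isFrobPreservingAt` — the kernel of Cor 4.10 (v)'s rigidity, used
by the functor file) and existence of a Frobenius-preserving morphism is a CONSISTENCY condition (`exists_frobPreserving_iff`).
§0 supplies the rank-one linear algebra over `RLine` (coordinates `coordEquiv`, THE pointed isomorphism `frobIso` and its
uniqueness `eq_frobIso_of_map_frob` = Prop 4.2 (ii) «a unique isomorphism … that maps the distinguished element … to the
distinguished element», line form). HONEST FRAMING: definitions in disclosed coordinates + elementary linear algebra; nothing here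
asserts a disputed claim or takes a side on [IUTchIII] Cor 3.12; typed ≠ proved.
-/

open CategoryTheory

universe u w

/-! ### §0. Rank-one real lines with a distinguished element: coordinates and THE pointed isomorphism -/

namespace Literature.AnabelianGeometry.AbsoluteAnabelian.RLine

variable (L : RLine.{w})

/-- `r ↦ r·frob` is injective (`frob ≠ 0` in a real vector space). [cite: MochizukiAbsTopIII2015, Prop 5.8 (iii) p. 140] -/
theorem smul_frob_injective : Function.Injective fun r : ℝ => r • L.frob :=
  smul_left_injective ℝ L.frob_ne_zero

/-- The coordinate of `x` is `r` iff `x = r·frob`. [cite: MochizukiAbsTopIII2015, Def 5.9 (i) p. 143] -/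
theorem coord_eq_iff {x : L.carrier} {r : ℝ} : L.coord x = r ↔ x = r • L.frob := by
  constructor
  · rintro rfl; exact (L.coord_smul_frob x).symm
  · intro h
    apply L.smul_frob_injective
    simp only
    rw [L.coord_smul_frob x, h]

/-- `coord (r·frob) = r`. [cite: MochizukiAbsTopIII2015, Def 5.9 (i) p. 143] -/
@[simp] theorem coord_smul_frob' (r : ℝ) : L.coord (r • L.frob) = r := (L.coord_eq_iff).2 rfl

/-- `coord frob = 1` ("corresponding to `1 ∈ ℝ`"). [cite: MochizukiAbsTopIII2015, Def 5.9 (i) p. 143] -/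
@[simp] theorem coord_frob : L.coord L.frob = 1 := by
  simpa using L.coord_smul_frob' 1

/-- `coord` is additive. [cite: MochizukiAbsTopIII2015, Def 5.9 (i) p. 143] -/
theorem coord_add (x y : L.carrier) : L.coord (x + y) = L.coord x + L.coord y := by
  rw [coord_eq_iff, add_smul, L.coord_smul_frob, L.coord_smul_frob]

/-- `coord` is `ℝ`-linear. [cite: MochizukiAbsTopIII2015, Def 5.9 (i) p. 143] -/
theorem coord_smul (r : ℝ) (x : L.carrier) : L.coord (r • x) = r * L.coord x := by
  rw [coord_eq_iff, mul_smul, L.coord_smul_frob]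

/-- The coordinate isomorphism `R ⥲ ℝ`, `frob ↦ 1` (the isomorphism "`R ≅ ℝ` given by `F ↦ …`" of Prop 5.8 (iii) with
unit weight). [cite: MochizukiAbsTopIII2015, Prop 5.8 (iii) p. 140] -/
noncomputable def coordEquiv : L.carrier ≃ₗ[ℝ] ℝ where
  toFun := L.coord
  map_add' := L.coord_add
  map_smul' := L.coord_smul
  invFun r := r • L.frob
  left_inv x := L.coord_smul_frob x
  right_inv r := L.coord_smul_frob' r

/-- `coordEquiv` is `coord`. [cite: MochizukiAbsTopIII2015, Prop 5.8 (iii) p. 140] -/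
@[simp] theorem coordEquiv_apply (x : L.carrier) : L.coordEquiv x = L.coord x := rfl
/-- `coordEquiv⁻¹ r = r·frob`. [cite: MochizukiAbsTopIII2015, Prop 5.8 (iii) p. 140] -/
@[simp] theorem coordEquiv_symm_apply (r : ℝ) : L.coordEquiv.symm r = r • L.frob := rfl

variable (L' L'' : RLine.{w})

/-- THE isomorphism of pointed lines `L ⥲ L'`, `frob ↦ frob'` — the shape of every isomorphism
`R_{≥0}(†D^⊢)_v ⥲ R_{≥0}(‡D^⊢)_v` functorially induced by an isomorphism of `D^⊢`-prime-strips ([IUTchII] Cor 4.5 (ii):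
the distinguished elements `log^{D^⊢}(p_v)` are part of the reconstructed data). [cite: Mochizuki2012, Cor 4.5 (ii) p.132] -/
noncomputable def frobIso : L.carrier ≃ₗ[ℝ] L'.carrier := L.coordEquiv.trans L'.coordEquiv.symm

/-- `frobIso` in coordinates. [cite: Mochizuki2012, Cor 4.5 (ii) p.132] -/
@[simp] theorem frobIso_apply (x : L.carrier) : frobIso L L' x = L.coord x • L'.frob := rfl
/-- `frobIso` carries the distinguished element to the distinguished element. [cite: Mochizuki2012, Cor 4.5 (ii) p.132] -/
@[simp] theorem frobIso_frob : frobIso L L' L.frob = L'.frob := by simp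

/-- Rank one: a linear map out of `L` is determined by its value on `frob`. [cite: MochizukiAbsTopIII2015, Prop 5.8 (iii) p. 140] -/
theorem linearMap_ext_frob {M : Type*} [AddCommMonoid M] [Module ℝ M] {f g : L.carrier →ₗ[ℝ] M}
    (h : f L.frob = g L.frob) : f = g := by
  ext x
  rw [← L.coord_smul_frob x, map_smul, map_smul, h]

/-- Rank one: a linear isomorphism `L ⥲ L'` is determined by its value on `frob`. [cite: MochizukiAbsTopIII2015, Prop 5.8 (iii) p. 140] -/
theorem linearEquiv_ext_frob {f g : L.carrier ≃ₗ[ℝ] L'.carrier} (h : f L.frob = g L.frob) : f = g :=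
  LinearEquiv.toLinearMap_injective (linearMap_ext_frob L h)

/-- UNIQUENESS of the pointed isomorphism: any linear isomorphism `L ⥲ L'` matching the distinguished elements IS
`frobIso` ([IUTchII] Prop 4.2 (ii)/4.4 (ii) "a unique isomorphism of monoids … that maps the distinguished element … to
the distinguished element", line form). [cite: Mochizuki2012, Prop 4.2 (ii) p.124] -/
theorem eq_frobIso_of_map_frob (f : L.carrier ≃ₗ[ℝ] L'.carrier) (h : f L.frob = L'.frob) : f = frobIso L L' :=
  linearEquiv_ext_frob L L' (by rw [h, frobIso_frob])

/-- `frobIso L L = id`. [cite: Mochizuki2012, Prop 4.2 (ii) p.124] -/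
@[simp] theorem frobIso_self : frobIso L L = LinearEquiv.refl ℝ _ :=
  (eq_frobIso_of_map_frob L L _ rfl).symm

/-- `frobIso` composes. [cite: Mochizuki2012, Prop 4.2 (ii) p.124] -/
theorem frobIso_trans : (frobIso L L').trans (frobIso L' L'') = frobIso L L'' :=
  eq_frobIso_of_map_frob L L'' _ (by simp)

/-- `frobIso` inverts. [cite: Mochizuki2012, Prop 4.2 (ii) p.124] -/
theorem frobIso_symm : (frobIso L L').symm = frobIso L' L :=
  eq_frobIso_of_map_frob L' L _ (by rw [LinearEquiv.symm_apply_eq, frobIso_frob])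

end Literature.AnabelianGeometry.AbsoluteAnabelian.RLine

/-! ### §1. The category of collections of data `(C^⊩, Prime(C^⊩) ⥲ V̲, {ρ_v}_v)` -/

namespace Literature.IUT.HodgeArakelov

open Literature.AnabelianGeometry.AbsoluteAnabelian Literature.IUT.HodgeTheaters

/-- **IUTchII:Cor4.5(ii)** (kurims p.132 l.19–37) / **IUTchII:Cor4.10(v)** (p.161 l.2–3 «consisting of a Frobenioid, a
bijection, and a collection of isomorphisms of topological monoids indexed by `V̲`»): a COLLECTION OF DATA
`(C, Prime(C) ⥲ V̲, {ρ_v : Φ_{C,v} ⥲ R_v}_{v ∈ V̲})` in the coordinates of the module docstring — for each `v` the target line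
`R_v` with its distinguished element (`line v`, an `RLine`: `R_{≥0}(‡D^⊢)_v ∋ log^{‡D^⊢}(p_v)` for `D^⊩(‡D^⊢)`) and the positive
scalar of `ρ_v` on the element of arithmetic degree `1` of the prime component `Φ_{C,v} ≅ ℝ_{≥0}`.
[cite: Mochizuki2012, Cor 4.5 (ii) p.132] -/
structure RlfData (V : Type u) : Type (max u (w + 1)) where
  /-- `R_v` with its distinguished element `(line v).frob` -/
  line : V → RLine.{w}
  /-- `ρ_v(element of degree 1) = rhoCoeff v · frob_v` -/
  rhoCoeff : V → ℝ
  /-- `ρ_v` is an isomorphism onto the nonnegative half-line: the scalar is positive -/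
  rhoCoeff_pos : ∀ v, 0 < rhoCoeff v

namespace RlfData

variable {V : Type u}

/-- The scalars of the `ρ_v` are nonzero. [cite: Mochizuki2012, Cor 4.5 (ii) p.132] -/
theorem rhoCoeff_ne_zero (X : RlfData.{u, w} V) (v : V) : X.rhoCoeff v ≠ 0 := (X.rhoCoeff_pos v).ne'

/-- **IUTchII:Cor4.10(v)** (kurims p.160 l.81 – p.161 l.3) «an isomorphism of collections of data […] consisting of a
Frobenioid, a bijection, and a collection of isomorphisms of topological monoids indexed by `V̲`»: the DEGREE `deg > 0` of the
equivalence of (realified) Frobenioids `C_X ⥲ C_Y` ([FrdI] Thm 6.4 (ii); it respects `Prime ⥲ V̲`, acting on every prime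
component by `d ↦ deg·d` in degree coordinates), the isomorphisms of the lines `R_{X,v} ⥲ R_{Y,v}`, and compatibility with the
`ρ_v`. [cite: Mochizuki2012, Cor 4.10 (v) p.160] -/
@[ext]
structure Hom (X Y : RlfData.{u, w} V) : Type (max u w) where
  /-- the degree of the equivalence of Frobenioids ([FrdI] Thm 6.4 (ii)) -/
  deg : ℝ
  /-- it is positive -/
  deg_pos : 0 < deg
  /-- the isomorphisms of topological monoids `R_{X,v} ⥲ R_{Y,v}` (as linear isomorphisms of the ambient lines) -/
  lineIso : ∀ v, (X.line v).carrier ≃ₗ[ℝ] (Y.line v).carrier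
  /-- compatibility with `ρ_{X,v}`, `ρ_{Y,v}`: the square `Φ_{X,v} → R_{X,v} → R_{Y,v}` = `Φ_{X,v} → Φ_{Y,v} → R_{Y,v}` on the
  element of degree `1` -/
  compat : ∀ v, lineIso v (X.rhoCoeff v • (X.line v).frob) = (deg * Y.rhoCoeff v) • (Y.line v).frob

namespace Hom

variable {X Y Z : RlfData.{u, w} V}

/-- The degree is nonzero. [cite: Mochizuki2012, Cor 4.10 (v) p.160] -/
theorem deg_ne_zero (f : Hom X Y) : f.deg ≠ 0 := f.deg_pos.ne'

/-- The line isomorphism of a morphism is FORCED by its degree: `frob_X ↦ (deg·c_{Y,v}/c_{X,v})·frob_Y`.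
[cite: Mochizuki2012, Cor 4.6 (ii) p.138] -/
theorem lineIso_frob (f : Hom X Y) (v : V) :
    f.lineIso v (X.line v).frob = (f.deg * Y.rhoCoeff v / X.rhoCoeff v) • (Y.line v).frob := by
  have h := f.compat v
  rw [map_smul] at h
  have hx := X.rhoCoeff_ne_zero v
  calc f.lineIso v (X.line v).frob
      = (X.rhoCoeff v)⁻¹ • (X.rhoCoeff v • f.lineIso v (X.line v).frob) := by
        rw [smul_smul, inv_mul_cancel₀ hx, one_smul]
    _ = (f.deg * Y.rhoCoeff v / X.rhoCoeff v) • (Y.line v).frob := by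
        rw [h, smul_smul, div_eq_inv_mul]

/-- A morphism of collections of data is DETERMINED BY ITS DEGREE. [cite: Mochizuki2012, Cor 4.6 (ii) p.138] -/
theorem ext_of_deg_eq {f g : Hom X Y} (h : f.deg = g.deg) : f = g := by
  refine Hom.ext h (funext fun v => RLine.linearEquiv_ext_frob _ _ ?_)
  rw [f.lineIso_frob, g.lineIso_frob, h]

/-- The identity isomorphism of a collection of data. [cite: Mochizuki2012, Cor 4.10 (v) p.160] -/
protected def id (X : RlfData.{u, w} V) : Hom X X where
  deg := 1
  deg_pos := one_pos
  lineIso _ := LinearEquiv.refl ℝ _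
  compat v := by rw [one_mul]; rfl

/-- Composition of isomorphisms of collections of data (degrees multiply). [cite: Mochizuki2012, Cor 4.10 (v) p.160] -/
protected def comp (f : Hom X Y) (g : Hom Y Z) : Hom X Z where
  deg := f.deg * g.deg
  deg_pos := mul_pos f.deg_pos g.deg_pos
  lineIso v := (f.lineIso v).trans (g.lineIso v)
  compat v := by
    rw [LinearEquiv.trans_apply, f.compat, mul_smul, map_smul, g.compat, smul_smul, ← mul_assoc]

/-- The inverse isomorphism (degree `deg⁻¹`). [cite: Mochizuki2012, Cor 4.10 (v) p.160] -/
protected noncomputable def inv (f : Hom X Y) : Hom Y X where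
  deg := f.deg⁻¹
  deg_pos := inv_pos.mpr f.deg_pos
  lineIso v := (f.lineIso v).symm
  compat v := by
    have hx := X.rhoCoeff_ne_zero v
    have hd := f.deg_ne_zero
    rw [LinearEquiv.symm_apply_eq, map_smul, f.lineIso_frob, smul_smul]
    congr 1
    field_simp

/-- The isomorphism of collections of data OF PRESCRIBED DEGREE `d > 0` between any two objects (its line isomorphisms
are the forced ones). [cite: Mochizuki2012, Cor 4.10 (v) p.161] -/
protected noncomputable def ofDeg (X Y : RlfData.{u, w} V) (d : ℝ) (hd : 0 < d) : Hom X Y where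
  deg := d
  deg_pos := hd
  lineIso v := (X.line v).coordEquiv.trans
    ((LinearEquiv.smulOfNeZero ℝ ℝ (d * Y.rhoCoeff v / X.rhoCoeff v)
      (div_ne_zero (mul_ne_zero hd.ne' (Y.rhoCoeff_ne_zero v)) (X.rhoCoeff_ne_zero v))).trans
      (Y.line v).coordEquiv.symm)
  compat v := by
    have hx := X.rhoCoeff_ne_zero v
    simp only [LinearEquiv.trans_apply, RLine.coordEquiv_apply, RLine.coord_smul_frob',
      LinearEquiv.smulOfNeZero_apply, RLine.coordEquiv_symm_apply, smul_eq_mul]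
    congr 1
    field_simp

end Hom

/-- **IUTchII:Cor4.10(v)** (kurims p.160) the CATEGORY of collections of data `(C^⊩, Prime ⥲ V̲, {ρ_v})` and their
isomorphisms. [cite: Mochizuki2012, Cor 4.10 (v) p.160] -/
instance instCategory : Category (RlfData.{u, w} V) where
  Hom := Hom
  id := Hom.id
  comp := Hom.comp
  id_comp f := Hom.ext_of_deg_eq (one_mul f.deg)
  comp_id f := Hom.ext_of_deg_eq (mul_one f.deg)
  assoc f g h := Hom.ext_of_deg_eq (mul_assoc f.deg g.deg h.deg)

/-- The identity has degree `1`. [cite: Mochizuki2012, Cor 4.10 (v) p.160] -/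
@[simp] theorem id_deg (X : RlfData.{u, w} V) : (𝟙 X : X ⟶ X).deg = 1 := rfl

/-- Degrees multiply under composition. [cite: Mochizuki2012, Cor 4.10 (v) p.160] -/
@[simp] theorem comp_deg {X Y Z : RlfData.{u, w} V} (f : X ⟶ Y) (g : Y ⟶ Z) : (f ≫ g).deg = f.deg * g.deg := rfl

/-- **IUTchII:Cor4.10(v)** (kurims p.160) every isomorphism of collections of data is invertible: a GROUPOID.
[cite: Mochizuki2012, Cor 4.10 (v) p.160] -/
noncomputable instance instGroupoid : Groupoid (RlfData.{u, w} V) where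
  inv := Hom.inv
  inv_comp f := Hom.ext_of_deg_eq (inv_mul_cancel₀ f.deg_ne_zero)
  comp_inv f := Hom.ext_of_deg_eq (mul_inv_cancel₀ f.deg_ne_zero)

/-! ### §2. The `ℝ_{>0}`-torsor structure: degrees, dilations, orbits (Cor 4.10 (v) p.161 l.30–33) -/

/-- **IUTchII:Cor4.10(v)** (kurims p.161 l.30–33) hom-sets are `ℝ_{>0}`-TORSORS: `(X ⟶ Y) ≃ ℝ_{>0}` by the degree.
[cite: Mochizuki2012, Cor 4.10 (v) p.161] -/
noncomputable def degEquiv (X Y : RlfData.{u, w} V) : (X ⟶ Y) ≃ {d : ℝ // 0 < d} where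
  toFun f := ⟨f.deg, f.deg_pos⟩
  invFun d := Hom.ofDeg X Y d.1 d.2
  left_inv _ := Hom.ext_of_deg_eq rfl
  right_inv _ := rfl

/-- Any two collections of data are isomorphic (as the print's `D^⊩(‡D^⊢)`, `‡C^⊩` all are: each is «isomorphic to …
`C^⊩_mod`», Cor 4.5 (ii)). [cite: Mochizuki2012, Cor 4.5 (ii) p.132] -/
theorem hom_nonempty (X Y : RlfData.{u, w} V) : Nonempty (X ⟶ Y) := ⟨Hom.ofDeg X Y 1 one_pos⟩

/-- **IUTchII:Cor4.10(v)** (kurims p.161 l.30–33) «the natural `R_{>0}`-actions on the Frobenioids involved obtained by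
multiplying the “arithmetic degrees” by a given element `∈ R_{>0}`»: the dilation of `X` by `d`, as an automorphism of the
collection of data. [cite: Mochizuki2012, Cor 4.10 (v) p.161] -/
noncomputable def dilate (X : RlfData.{u, w} V) (d : ℝ) (hd : 0 < d) : X ⟶ X := Hom.ofDeg X X d hd

/-- The dilation by `d` has degree `d`. [cite: Mochizuki2012, Cor 4.10 (v) p.161] -/
@[simp] theorem dilate_deg (X : RlfData.{u, w} V) (d : ℝ) (hd : 0 < d) : (X.dilate d hd).deg = d := rfl

/-- NON-RIGIDITY of the ambient category: a dilation by `d ≠ 1` is a NON-identity automorphism — `Aut(X) ≅ ℝ_{>0}`; the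
rigidity of Cor 4.10 (v) is a property of the FUNCTOR `D^⊩(−)` (§3), not of this category.
[cite: Mochizuki2012, Cor 4.10 (v) p.161] -/
theorem dilate_ne_id (X : RlfData.{u, w} V) {d : ℝ} (hd : 0 < d) (hd1 : d ≠ 1) : X.dilate d hd ≠ 𝟙 X := by
  intro h
  exact hd1 (by simpa using congrArg Hom.deg h)

/-- **IUTchII:Cor4.10(v)** (kurims p.161) the `ℝ_{>0}`-ORBIT of an isomorphism of data is the whole hom-set: every `f : X ⟶ Y`
is `(dilation of X) ≫ f₀`. [cite: Mochizuki2012, Cor 4.10 (v) p.161] -/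
theorem eq_dilate_comp {X Y : RlfData.{u, w} V} (f₀ f : X ⟶ Y) :
    f = X.dilate (f.deg / f₀.deg) (div_pos f.deg_pos f₀.deg_pos) ≫ f₀ :=
  Hom.ext_of_deg_eq (by simp [div_mul_cancel₀ _ f₀.deg_ne_zero])

/-- **IUTchII:Cor4.10(v)** (kurims p.161 l.5 «`R_{>0}`-orbits of the isomorphisms of collections of data») the `ℝ_{>0}`-orbit of an
isomorphism `κ : X ⥲ Y` of collections of data, as a poly-isomorphism (abc-iut-L5-t1's `PolyIso`): the dilations of `X`
followed by `κ`. [cite: Mochizuki2012, Cor 4.10 (v) p.161] -/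
def orbit {X Y : RlfData.{u, w} V} (κ : X ≅ Y) : PolyIso X Y :=
  {e | ∃ (d : ℝ) (hd : 0 < d), e.hom = X.dilate d hd ≫ κ.hom}

/-- **IUTchII:Cor4.10(v)** (kurims p.161) the `ℝ_{>0}`-orbit of ANY isomorphism of collections of data is the FULL
poly-isomorphism (torsor). [cite: Mochizuki2012, Cor 4.10 (v) p.161] -/
theorem orbit_eq_full {X Y : RlfData.{u, w} V} (κ : X ≅ Y) : orbit κ = PolyIso.full X Y := by
  ext e
  simp only [PolyIso.full, Set.mem_univ, iff_true]
  exact ⟨e.hom.deg / κ.hom.deg, div_pos e.hom.deg_pos κ.hom.deg_pos, eq_dilate_comp κ.hom e.hom⟩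

/-! ### §2'. Cor 4.6 (ii): «uniquely determined by … `Prime ⥲ V̲` and local isomorphisms»; Frobenius-preserving morphisms -/

/-- **IUTchII:Cor4.6(ii)** (kurims p.138 l.2–7) «an isomorphism of Frobenioids `‡C^⊩ ⥲ D^⊩(‡D^⊢)` that is uniquely determined
by the condition that it be compatible with the respective bijections `Prime(−) ⥲ V̲` and local isomorphisms of topological
monoids for each `v ∈ V̲`» — SHARP FORM: an isomorphism of collections of data is determined by its local isomorphism at ANY
ONE `v`. [cite: Mochizuki2012, Cor 4.6 (ii) p.138] -/
theorem hom_ext_of_lineIso_eq {X Y : RlfData.{u, w} V} {f g : X ⟶ Y} (v : V) (h : f.lineIso v = g.lineIso v) :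
    f = g := by
  apply Hom.ext_of_deg_eq
  have hf := f.lineIso_frob v
  rw [h, g.lineIso_frob v] at hf
  have h2 : f.deg * Y.rhoCoeff v / X.rhoCoeff v = g.deg * Y.rhoCoeff v / X.rhoCoeff v :=
    (Y.line v).smul_frob_injective hf.symm
  have hy := Y.rhoCoeff_ne_zero v
  have hx := X.rhoCoeff_ne_zero v
  rw [div_left_inj' hx] at h2
  exact mul_right_cancel₀ hy h2

/-- A morphism of collections of data is FROBENIUS-PRESERVING at `v` when its line isomorphism carries the distinguished
element of `R_{X,v}` to that of `R_{Y,v}` (as the isomorphisms `R_{≥0}(†D^⊢)_v ⥲ R_{≥0}(‡D^⊢)_v` induced by `D^⊢`-prime-strip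
isomorphisms do, and as the local isomorphisms `Ψ^R_{‡F^⊢_v} ⥲ R_{≥0}(‡D^⊢_v)` of Prop 4.2 (ii)/4.4 (ii) do).
[cite: Mochizuki2012, Prop 4.2 (ii) p.124] -/
def Hom.IsFrobPreservingAt {X Y : RlfData.{u, w} V} (f : X ⟶ Y) (v : V) : Prop :=
  f.lineIso v (X.line v).frob = (Y.line v).frob

/-- A Frobenius-preserving line isomorphism PINS THE DEGREE: `deg = c_{X,v}/c_{Y,v}`. [cite: Mochizuki2012, Cor 4.6 (ii) p.138] -/
theorem deg_eq_of_isFrobPreservingAt {X Y : RlfData.{u, w} V} (f : X ⟶ Y) (v : V) (h : f.IsFrobPreservingAt v) :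
    f.deg = X.rhoCoeff v / Y.rhoCoeff v := by
  have hf := f.lineIso_frob v
  rw [h] at hf
  have h2 : f.deg * Y.rhoCoeff v / X.rhoCoeff v = 1 :=
    (Y.line v).smul_frob_injective
      (show (f.deg * Y.rhoCoeff v / X.rhoCoeff v) • (Y.line v).frob = (1 : ℝ) • (Y.line v).frob by
        rw [one_smul]; exact hf.symm)
  have hy := Y.rhoCoeff_ne_zero v
  have hx := X.rhoCoeff_ne_zero v
  field_simp at h2
  field_simp
  linarith

/-- **IUTchII:Cor4.10(v)** (kurims p.160) KERNEL OF THE RIGIDITY: an ENDOMORPHISM of a collection of data whose line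
isomorphism at some `v` fixes the distinguished element is the IDENTITY (although `Aut ≅ ℝ_{>0}`, `dilate_ne_id`).
[cite: Mochizuki2012, Cor 4.10 (v) p.160] -/
theorem eq_id_of_isFrobPreservingAt {X : RlfData.{u, w} V} (f : X ⟶ X) (v : V) (h : f.IsFrobPreservingAt v) :
    f = 𝟙 X :=
  Hom.ext_of_deg_eq (by rw [deg_eq_of_isFrobPreservingAt f v h, div_self (X.rhoCoeff_ne_zero v)]; rfl)

/-- Two morphisms `X ⟶ Y` both Frobenius-preserving at some `v` coincide (Cor 4.6 (ii)'s uniqueness for the Kummer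
isomorphism `‡C^⊩ ⥲ D^⊩(‡D^⊢)`, whose local isomorphisms are the Frobenius-preserving ones of Prop 4.2 (ii)/4.4 (ii)).
[cite: Mochizuki2012, Cor 4.6 (ii) p.138] -/
theorem hom_eq_of_isFrobPreservingAt {X Y : RlfData.{u, w} V} (f g : X ⟶ Y) (v : V) (hf : f.IsFrobPreservingAt v)
    (hg : g.IsFrobPreservingAt v) : f = g :=
  Hom.ext_of_deg_eq (by rw [deg_eq_of_isFrobPreservingAt f v hf, deg_eq_of_isFrobPreservingAt g v hg])

/-- EXISTENCE is a consistency condition (typed ≠ proved): a morphism `X ⟶ Y` Frobenius-preserving at EVERY `v` exists iff the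
ratios `c_{X,v}/c_{Y,v}` do not depend on `v` — i.e. iff ONE positive real `d` satisfies `c_{X,v} = d·c_{Y,v}` for all `v`.
[cite: Mochizuki2012, Cor 4.6 (ii) p.138] -/
theorem exists_frobPreserving_iff (X Y : RlfData.{u, w} V) :
    (∃ f : X ⟶ Y, ∀ v, f.IsFrobPreservingAt v) ↔ ∃ d : ℝ, 0 < d ∧ ∀ v, X.rhoCoeff v = d * Y.rhoCoeff v := by
  constructor
  · rintro ⟨f, hf⟩
    refine ⟨f.deg, f.deg_pos, fun v => ?_⟩
    rw [deg_eq_of_isFrobPreservingAt f v (hf v), div_mul_cancel₀ _ (Y.rhoCoeff_ne_zero v)]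
  · rintro ⟨d, hd, h⟩
    refine ⟨Hom.ofDeg X Y d hd, fun v => ?_⟩
    show (Hom.ofDeg X Y d hd).lineIso v (X.line v).frob = (Y.line v).frob
    rw [Hom.lineIso_frob]
    conv_rhs => rw [← one_smul ℝ (Y.line v).frob]
    congr 1
    change d * Y.rhoCoeff v / X.rhoCoeff v = 1
    rw [← h v, div_self (X.rhoCoeff_ne_zero v)]

end RlfData

end Literature.IUT.HodgeArakelov
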